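import Summits.Ventures.LatticeQCDFlow.TrivializingMaps.HaarTraceMomentsSUn
import Summits.Ventures.LatticeQCDFlow.TrivializingMaps.WilsonSU2FisherZeroRadius
import Summits.Ventures.LatticeQCDFlow.TrivializingMaps.ConstantsCumulants

/-!
HONEST FRAMING: exact (Metropolis-corrected) sampling algorithms for lattice gauge theory; figures
of merit are autocorrelation/cost numbers at stated couplings and volumes; no continuum-physics
claim.

# WilsonLuscherConstantsExplicit — the first two flow constants of EVERY Lüscher series of the
# `SU(n)` Wilson action, in every volume `L ≥ 2`: `Ċ^{(0)} = -n·#plaq`,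
# `Ċ^{(1)} = m₂(n)·#plaq` (`= #plaq` for `SU(2)`, `= #plaq/2` for `n ≥ 3`) (lean-2 GEN-6, ours)

Venture-side (OURS).  Cell `lqcd-flow` (pub-lqcd), unit `pub-lqcd-lean-2-g6`, 2026-08-22.  The tree's
`ConstantsCumulants` (Lüscher (4.9): `Ċ^{(0)} = -⟨S⟩₀`, `Ċ^{(1)} = Var₀ S` for every smooth Lüscher
series) composed with the β = 0 Haar moments of this generation (`PlaquetteHaarMoments`,
`WilsonVarianceExtensive`, `WilsonSU2FisherZeroRadius`, `HaarTraceMomentsSUn`):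

* **`wilson_luscher_const_zero`** — `Ċ^{(0)} = -(n · #plaquettes)` for every Lüscher series
  `(S̃^{(k)}, Ċ^{(k)})` of `S_W = ∑_p Re tr(1 - U_p)` on `SU(n)`, `n ≥ 2`, `L ≥ 2`;
* **`wilson_luscher_const_one`** — `Ċ^{(1)} = m₂(n) · #plaquettes`, `m₂(n) = ∫_{SU(n)}(Re tr)²`;
  `wilson_luscher_const_one_su2` (`= #plaquettes`), `wilson_luscher_const_one_sun` (`= #plaquettes/2`,
  `n ≥ 3`).
These are EXTENSIVE (∝ volume) and the per-plaquette values `-n`, `m₂(n)` are volume-independent —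
a kernel-checked anchor for any implementation of Lüscher's recursion (engines' unit tests).

NOT CLAIMED: higher constants; `L = 1`; anything at `β ≠ 0`.
-/

open MeasureTheory ProbabilityTheory Filter Topology Complex Set Metric
open Literature.MathematicalPhysics.QuantumFieldTheory
open Literature.MathematicalPhysics.QuantumFieldTheory.Luscher2010
open Literature.MathematicalPhysics.QuantumFieldTheory.WilsonFlow (coeConfig continuous_coeConfig)
open scoped Matrix Matrix.Norms.Frobenius ContDiff

namespace Summit.Ventures.LatticeQCDFlow.TrivializingMaps

variable {d L n : ℕ} [NeZero L] {B : SuBasis n} {Sk : ℕ → AmbConfig d L n → ℝ} {c : ℕ → ℝ}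

/-- **`Ċ^{(0)} = -n·#plaquettes`** for every smooth Lüscher series of the `SU(n)` Wilson action
(`n ≥ 2`, `L ≥ 2`). [ours] -/
theorem wilson_luscher_const_zero (hL : 2 ≤ L) (hn : 2 ≤ n)
    (h : IsLuscherSeries B (ambWilsonAction : AmbConfig d L n → ℝ) Sk c)
    (hsm : ∀ k, ContDiff ℝ ∞ (Sk k)) :
    c 0 = -((n : ℝ) * Fintype.card (Plaquette d L)) := by
  rw [IsLuscherSeries.const_zero_eq h contDiff_ambWilsonAction hsm]
  unfold haarMean
  simp_rw [StrongCoupling.ambWilsonAction_coeConfig]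
  rw [integral_wilsonAction_trivial hL hn]

/-- **`Ċ^{(1)} = m₂(n)·#plaquettes`** (`m₂(n) = ∫_{SU(n)} (Re tr)² dHaar`) for every smooth Lüscher
series of the `SU(n)` Wilson action (`n ≥ 2`, `L ≥ 2`). [ours] -/
theorem wilson_luscher_const_one (hL : 2 ≤ L) (hn : 2 ≤ n)
    (h : IsLuscherSeries B (ambWilsonAction : AmbConfig d L n → ℝ) Sk c)
    (hsm : ∀ k, ContDiff ℝ ∞ (Sk k)) :
    c 1 = (∫ g, ((g : Matrix (Fin n) (Fin n) ℂ)).trace.re ^ 2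
        ∂(haarProbability (Matrix.specialUnitaryGroup (Fin n) ℂ))) * Fintype.card (Plaquette d L) := by
  rw [IsLuscherSeries.const_one_eq h contDiff_ambWilsonAction hsm, ← wilson_variance_eq hL hn]
  haveI : IsProbabilityMeasure (trivialMeasure (Matrix.specialUnitaryGroup (Fin n) ℂ) d L) := by
    unfold trivialMeasure; infer_instance
  have hc : Continuous fun U : GaugeConfig d L (Matrix.specialUnitaryGroup (Fin n) ℂ) =>
      ambWilsonAction (coeConfig U) := continuous_comp_coeConfig contDiff_ambWilsonAction
  obtain ⟨b, hb⟩ := exists_abs_le_of_contDiff (d := d) (L := L) (n := n) contDiff_ambWilsonAction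
  have hmem : MemLp (fun U : GaugeConfig d L (Matrix.specialUnitaryGroup (Fin n) ℂ) =>
      ambWilsonAction (coeConfig U)) 2 (trivialMeasure (Matrix.specialUnitaryGroup (Fin n) ℂ) d L) :=
    MemLp.of_bound (integrable_trivialMeasure_of_continuous hc).aestronglyMeasurable b
      (ae_of_all _ fun U => by rw [Real.norm_eq_abs]; exact hb U)
  rw [variance_eq_sub hmem]
  unfold haarMean
  rfl

/-- **`Ċ^{(1)} = #plaquettes` for `SU(2)`** (`L ≥ 2`). [ours] -/
theorem wilson_luscher_const_one_su2 (hL : 2 ≤ L) {B : SuBasis 2} {Sk : ℕ → AmbConfig d L 2 → ℝ}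
    {c : ℕ → ℝ} (h : IsLuscherSeries B (ambWilsonAction : AmbConfig d L 2 → ℝ) Sk c)
    (hsm : ∀ k, ContDiff ℝ ∞ (Sk k)) :
    c 1 = Fintype.card (Plaquette d L) := by
  rw [wilson_luscher_const_one hL le_rfl h hsm, haarSqReTrace_su2, one_mul]

/-- **`Ċ^{(1)} = #plaquettes / 2` for `SU(n)`, `n ≥ 3`** (`L ≥ 2`). [ours] -/
theorem wilson_luscher_const_one_sun (hL : 2 ≤ L) (hn : 3 ≤ n)
    (h : IsLuscherSeries B (ambWilsonAction : AmbConfig d L n → ℝ) Sk c)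
    (hsm : ∀ k, ContDiff ℝ ∞ (Sk k)) :
    c 1 = Fintype.card (Plaquette d L) / 2 := by
  rw [wilson_luscher_const_one hL (by omega) h hsm, haarSqReTrace_eq_half hn]
  ring

/-- The canonical Wilson series (`wilsonSk`, `wilsonConst`): `Ċ^{(0)} = -n·#plaq` and
`Ċ^{(1)} = m₂(n)·#plaq`, every volume `L ≥ 2`. [ours] -/
theorem wilsonConst_zero_and_one (hL : 2 ≤ L) (hn : 2 ≤ n) (B : SuBasis n) :
    wilsonConst d L B 0 = -((n : ℝ) * Fintype.card (Plaquette d L)) ∧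
      wilsonConst d L B 1 = (∫ g, ((g : Matrix (Fin n) (Fin n) ℂ)).trace.re ^ 2
        ∂(haarProbability (Matrix.specialUnitaryGroup (Fin n) ℂ))) * Fintype.card (Plaquette d L) :=
  ⟨wilson_luscher_const_zero hL hn (isLuscherSeries_wilsonSk B) (contDiff_wilsonSk B),
    wilson_luscher_const_one hL hn (isLuscherSeries_wilsonSk B) (contDiff_wilsonSk B)⟩

end Summit.Ventures.LatticeQCDFlow.TrivializingMaps
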